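import Literature.MathematicalPhysics.QuantumFieldTheory.Balaban1983to89.Node00.Record13SepCoPHV
import Summits.QuantumFields.YangMills.Theorems.BalabanUVNodesK3V5Defs

/-!
# n17-w2 g6 — K3⁸ VERSION-SLOT PROBE of the K4 rates row and of K3⁷ v5's prefix-keyed faces (scratch, kernel; for plan g85's `D85-REV28/` SHAPE SHEET)

Cell `pub-ymgap`, WIDTH SEAT `pub-ymgap-dag-n17-w2` (gen 6) on NODE n17 (NE4; (D4) read-out lane), key K3⁷ stmt-QuantumFields-20544; count-neutral; a CRUX SCRATCH (no proposal,
no Theorems path), the N17 ∕ (D4) lineage's junction with director-ym №210 (A)(2) ∕ plan g84–g85's rev-28 revision «K3⁸ := K3⁷ over `(v : Node00.Revision₁₃ F 2 θ h)` at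
`Node00.datumOfRecord₁₃SepCoPHV F 2 θ h v`» (DEF-1 g8 `Node00/Record13SepCoPHV.lean` p620607 ✓ + PREVIEW-CERT `Cruxes/EndpointGivenBR13SepCoPH/DEF_1_K19VersionSlotSketch.lean`;
CRIT-2 g3 `Crit2VersionSlotProbe.lean` probed the β-face and the B12-face).

THE POINT (kernel, every `v`, all by `Iff.rfl` ∕ `rfl` off DEF-1's faces `βfun_… ∕ tuned_… ∕ scheme_datumOfRecord₁₃SepCoPHV`):
(1) the K4 RATES ROW is VERSION-FREE — `N17At` (NE4 on the datum reads `D.βfun` only), `ReadOutAt` ((D4): `RepresentsA∕B … D.βfun` only), hence dag-n16-e's `RatesHolderAt D R β`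
    and K3⁷ v5's `PHolderD4 β D R` (mirror `Thm/…K3V5Defs`) read THE SAME at the revised datum and at the record;
(2) the CRUX PREFIX is VERSION-FREE except its first antecedent — `ForSmallCouplings D concl` (reads `D.Tuned` = flow only), `DagBinding.EndpointExistence D.C.toB12` (DEF-1), the
    partition functions `T4GenFunBounds.schemeZ (D.scheme g₀)` read by `KeyedExtraction` (scheme reads `av` only); ONLY `B16.EndStatementBPrinted D.C` moves (ρ-pointwise via Cor. 3);
(3) CONSEQUENCE for the K3⁸ skeleton (v5 → «v6»): the two stub TEXTS re-key by ONE extra binder `(v : Node00.Revision₁₃ F 2 θ h)` with (B), END, `ForSmallCouplings`, `PHolderD4`,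
    `schemeZ ∘ scheme` read AT THE SLOT — and every (B)-FREE supplier road of a v5 face (the `ForSmallCouplings.of_forall` roads of the N14∕N15∕N16∕N18∕N22∕(D4) lanes, the N20∕N21
    faces, which never read the datum) TRANSFERS TO EVERY `v` VERBATIM (`keyedRatesHolderD4V_of_bFree`, `keyedCoreEdgeHolderD4V_of_bFree`, `keyedExtractionV_of_bFree` below);
    a road that CONSUMES (B) must accept (B) at the revised datum (Thm 1's half is version-free too, DEF-1 `thm1Printed_datumOfRecord₁₃SepCoPHV_iff`; only the Cor. 3 half is
    ρ-pointwise); the DOOR `v := Revision₁₃.refl` returns each v5 face (`…_of_V`).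
The `…V` predicates below are CANDIDATE TEXTS written by the three substitutions of DEF-1's PREVIEW-CERT applied to v5's `KeyedRatesHolderD4 ∕ KeyedCoreEdgeHolderD4 ∕
KeyedExtraction` (mirror names of `Thm/…K3V5Defs`); they are NOT registered stub texts and NOT the plan's — the plan's `D85-REV28/` kit decides the K3⁸ skeleton.

HONEST FRAMING: `Iff.rfl` ∕ `rfl` bookkeeping over typed SHAPES; nothing of Bałaban asserted or instantiated; no stub proved; NE4 NOT IN PRINT for d = 4 ([Balaban1987RG1] p. 264)
and NOT proved; N17 NOT discharged; K3⁷ 20544 OPEN (K3⁸ not yet born); counts UNMOVED (typed 28∕28 · discharged 5∕28); one finite 𝕋⁴ programme at fixed ε — R4 closes the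
CONDITIONAL finite-𝕋⁴ rung `BalabanLadder.UV` only; the Yang–Mills mass gap (Clay) is NOT proved by any of this; nothing continuum ∕ ℝ⁴ ∕ OS.
-/

noncomputable section

namespace Summit.QuantumFields.YangMills.Cruxes.SpineGivenEndpointR13SepCoPH.N17W2K3R8VersionSlotProbe

open Literature.MathematicalPhysics.QuantumFieldTheory.Balaban1983to89
open Literature.MathematicalPhysics.QuantumFieldTheory.Balaban1983to89.T4Continuum
open T4ContinuumYM4Torus (ForSmallCouplings)
open Summit.QuantumFields.BalabanUV.T4Continuum
open Summit.QuantumFields.BalabanUV.T4Continuum.Spine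
open YMDAG.UVSplit
open Node00 (Stage13HParams datumOfRecord₁₃CoPH datumOfRecord₁₃SepCoPH datumOfRecord₁₃SepCoPHV Revision₁₃)
open Summit.QuantumFields.YangMills.BalabanUVNodes.SpineRatesHolder (RatesHolderAt)
open Summit.QuantumFields.YangMills.Theorems.K3V5Defs (RateReadingFn SpineReading PHolderD4 KeyedRatesHolderD4 KeyedCoreEdgeHolderD4 KeyedExtraction)

/-! ## §1 The K4 rates row at the revised datum = at the record (every `v`; `Iff.rfl` — both `βfun`s ARE `betaOfRecord₁₃`) -/

section Faces

variable (F : T4Family) (θ : Stage13HParams F 2) (h : θ.Provisos₁₃SepCoPH F 2) (v : Revision₁₃ F 2 θ h)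

/-- N17's face (NE4 ON THE DATUM reads `D.βfun` only) is VERSION-FREE. -/
theorem n17At_slot_iff (u : U3Carriers) : N17At (datumOfRecord₁₃SepCoPHV F 2 θ h v) u ↔ N17At (datumOfRecord₁₃SepCoPH F 2 θ h) u := Iff.rfl

/-- (D4)'s face (the β-read-out binders read `D.βfun` only; this lineage's g0 `readOutAt_congr_βfun`) is VERSION-FREE. -/
theorem readOutAt_slot_iff (u : U3Carriers) : ReadOutAt (datumOfRecord₁₃SepCoPHV F 2 θ h v) u ↔ ReadOutAt (datumOfRecord₁₃SepCoPH F 2 θ h) u := Iff.rfl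

/-- dag-n16-e's R-β RATES ROW (its only datum-reading conjunct is N17's) is VERSION-FREE. -/
theorem ratesHolderAt_slot_iff (R : RateCarriers 2) (β : ℝ) :
    RatesHolderAt (datumOfRecord₁₃SepCoPHV F 2 θ h v) R β ↔ RatesHolderAt (datumOfRecord₁₃SepCoPH F 2 θ h) R β := Iff.rfl

/-- K3⁷ v5's rates predicate `PHolderD4 β D R` (mirror `Thm/…K3V5Defs`) is VERSION-FREE; right-hand side at the CORE-provisos datum v5 keys on (`datumOfRecord₁₃SepCoPH … h =
datumOfRecord₁₃CoPH … h.toCore`, `rfl`). -/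
theorem pHolderD4_slot_iff (β : ℝ) (R : RateCarriers 2) :
    PHolderD4 β (datumOfRecord₁₃SepCoPHV F 2 θ h v) R ↔ PHolderD4 β (datumOfRecord₁₃CoPH F 2 θ h.toCore) R := Iff.rfl

/-- the crux prefix `ForSmallCouplings D` (reads `D.Tuned` = the flow only; DEF-1 `tuned_datumOfRecord₁₃SepCoPHV_iff`) is VERSION-FREE, for every conclusion. -/
theorem forSmallCouplings_slot_iff (concl : (ℕ → ℝ) → Prop) :
    ForSmallCouplings (datumOfRecord₁₃SepCoPHV F 2 θ h v) concl ↔ ForSmallCouplings (datumOfRecord₁₃CoPH F 2 θ h.toCore) concl := Iff.rfl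

/-- the UV endpoint binder is VERSION-FREE (DEF-1 `endpointExistence_datumOfRecord₁₃SepCoPHV_iff`, restated at the core-provisos datum). -/
theorem endpointExistence_slot_iff :
    DagBinding.EndpointExistence (datumOfRecord₁₃SepCoPHV F 2 θ h v).C.toB12 ↔ DagBinding.EndpointExistence (datumOfRecord₁₃CoPH F 2 θ h.toCore).C.toB12 := Iff.rfl

/-- the partition functions N27x's extraction identities read (`KeyedExtraction`: `schemeZ (D.scheme g₀) os K t`) are VERSION-FREE (DEF-1 `scheme_datumOfRecord₁₃SepCoPHV`). -/
theorem schemeZ_slot (g₀ : ℕ → ℝ) (os : List (ULoop F)) (K : ℕ) (t : ℝ) :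
    T4GenFunBounds.schemeZ ((datumOfRecord₁₃SepCoPHV F 2 θ h v).scheme g₀) os K t =
      T4GenFunBounds.schemeZ ((datumOfRecord₁₃CoPH F 2 θ h.toCore).scheme g₀) os K t := rfl

end Faces

/-! ## §2 CANDIDATE slot-keyed texts of v5's three prefix-keyed faces (DEF-1's three substitutions; NOT registered, NOT the plan's) -/

/-- CANDIDATE «K4 at the slot»: v5's `KeyedRatesHolderD4 β rr` under one extra binder `v`, with (B), END, `ForSmallCouplings`, `PHolderD4` read at `datumOfRecord₁₃SepCoPHV F 2 θ h v`
(the reading `rr` stays keyed on the CORE provisos, `h.toCore`). -/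
def KeyedRatesHolderD4V (β : ℝ) (rr : RateReadingFn) : Prop :=
  ∀ (F : T4Family) (θ : Stage13HParams F 2) (h : θ.Provisos₁₃SepCoPH F 2) (v : Revision₁₃ F 2 θ h), (θ.ZhUnity F 2 ∧ θ.SlotsNondegenerate₁₃ F 2) → θ.Admissible F 2 →
    B16.EndStatementBPrinted (datumOfRecord₁₃SepCoPHV F 2 θ h v).C → DagBinding.EndpointExistence (datumOfRecord₁₃SepCoPHV F 2 θ h v).C.toB12 →
      ForSmallCouplings (datumOfRecord₁₃SepCoPHV F 2 θ h v) fun g₀ => ∀ os : List (ULoop F), PHolderD4 β (datumOfRecord₁₃SepCoPHV F 2 θ h v) (rr F θ h.toCore g₀ os)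

/-- the (B)-FREE, END-FREE shape of the K4 face — what every ∀-`g₀` supplier road (`ForSmallCouplings.of_forall`) and every road not reading (B) actually proves. -/
def KeyedRatesHolderD4BFree (β : ℝ) (rr : RateReadingFn) : Prop :=
  ∀ (F : T4Family) (θ : Stage13HParams F 2) (hP : θ.Provisos₁₃CoPH F 2), (θ.ZhUnity F 2 ∧ θ.SlotsNondegenerate₁₃ F 2) → θ.Admissible F 2 →
    ForSmallCouplings (datumOfRecord₁₃CoPH F 2 θ hP) fun g₀ => ∀ os : List (ULoop F), PHolderD4 β (datumOfRecord₁₃CoPH F 2 θ hP) (rr F θ hP g₀ os)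

/-- **(3) a (B)-free road of v5's K4 face TRANSFERS TO EVERY VERSION `v` VERBATIM** (the two `Iff.rfl` faces of §1). -/
theorem keyedRatesHolderD4V_of_bFree {β : ℝ} {rr : RateReadingFn} (hfree : KeyedRatesHolderD4BFree β rr) : KeyedRatesHolderD4V β rr :=
  fun F θ h _v hG hθ _ _ => hfree F θ h.toCore hG hθ

/-- … and of course gives v5's own (B)-keyed face. -/
theorem keyedRatesHolderD4_of_bFree {β : ℝ} {rr : RateReadingFn} (hfree : KeyedRatesHolderD4BFree β rr) : KeyedRatesHolderD4 β rr :=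
  fun F θ hP hG hθ _ _ => hfree F θ hP hG hθ

/-- DOOR (`v := Revision₁₃.refl`): the slot-keyed K4 face at every `v` gives v5's face on the SEPARATED-provisos tuples (the item's own key; `datumOfRecord₁₃SepCoPHV … (.refl) =
datumOfRecord₁₃SepCoPH …` by `rfl`). -/
theorem keyedRatesHolderD4Sep_of_V {β : ℝ} {rr : RateReadingFn} (hV : KeyedRatesHolderD4V β rr) (F : T4Family) (θ : Stage13HParams F 2) (h : θ.Provisos₁₃SepCoPH F 2)
    (hG : θ.ZhUnity F 2 ∧ θ.SlotsNondegenerate₁₃ F 2) (hθ : θ.Admissible F 2) (hB : B16.EndStatementBPrinted (datumOfRecord₁₃SepCoPH F 2 θ h).C)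
    (hE : DagBinding.EndpointExistence (datumOfRecord₁₃SepCoPH F 2 θ h).C.toB12) :
    ForSmallCouplings (datumOfRecord₁₃CoPH F 2 θ h.toCore) fun g₀ => ∀ os : List (ULoop F), PHolderD4 β (datumOfRecord₁₃CoPH F 2 θ h.toCore) (rr F θ h.toCore g₀ os) :=
  hV F θ h (Revision₁₃.refl F 2 θ h) hG hθ hB hE

/-- CANDIDATE «N19′ at the slot»: v5's `KeyedCoreEdgeHolderD4 β cr rr` under the binder `v`, prefix and `PHolderD4` read at the revised datum (the spine reading `cr` and the rate reading
`rr` stay keyed on the core provisos). -/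
def KeyedCoreEdgeHolderD4V (β : ℝ) (cr : SpineReading) (rr : RateReadingFn) : Prop :=
  ∀ (F : T4Family) (θ : Stage13HParams F 2) (h : θ.Provisos₁₃SepCoPH F 2) (v : Revision₁₃ F 2 θ h), (θ.ZhUnity F 2 ∧ θ.SlotsNondegenerate₁₃ F 2) → θ.Admissible F 2 →
    B16.EndStatementBPrinted (datumOfRecord₁₃SepCoPHV F 2 θ h v).C → DagBinding.EndpointExistence (datumOfRecord₁₃SepCoPHV F 2 θ h v).C.toB12 →
      ForSmallCouplings (datumOfRecord₁₃SepCoPHV F 2 θ h v) fun g₀ => ∀ os : List (ULoop F),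
        PHolderD4 β (datumOfRecord₁₃SepCoPHV F 2 θ h v) (rr F θ h.toCore g₀ os) → letI := (cr F θ h.toCore g₀ os).dec
          ∃ δ : ℕ → ℝ, NE7.Core (cr F θ h.toCore g₀ os).l₀ (cr F θ h.toCore g₀ os).vol (cr F θ h.toCore g₀ os).T (cr F θ h.toCore g₀ os).Bad
            (fun K t τ => (cr F θ h.toCore g₀ os).A K t τ - (cr F θ h.toCore g₀ os).shA K t τ)
            (fun K t τ => (cr F θ h.toCore g₀ os).B K t τ - (cr F θ h.toCore g₀ os).shB K t τ) δ ∧ Summable δ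

/-- the (B)-FREE, END-FREE shape of the N19′ face (every road not reading (B) ∕ END proves this). -/
def KeyedCoreEdgeHolderD4BFree (β : ℝ) (cr : SpineReading) (rr : RateReadingFn) : Prop :=
  ∀ (F : T4Family) (θ : Stage13HParams F 2) (hP : θ.Provisos₁₃CoPH F 2), (θ.ZhUnity F 2 ∧ θ.SlotsNondegenerate₁₃ F 2) → θ.Admissible F 2 →
    ForSmallCouplings (datumOfRecord₁₃CoPH F 2 θ hP) fun g₀ => ∀ os : List (ULoop F),
      PHolderD4 β (datumOfRecord₁₃CoPH F 2 θ hP) (rr F θ hP g₀ os) → letI := (cr F θ hP g₀ os).dec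
        ∃ δ : ℕ → ℝ, NE7.Core (cr F θ hP g₀ os).l₀ (cr F θ hP g₀ os).vol (cr F θ hP g₀ os).T (cr F θ hP g₀ os).Bad
          (fun K t τ => (cr F θ hP g₀ os).A K t τ - (cr F θ hP g₀ os).shA K t τ) (fun K t τ => (cr F θ hP g₀ os).B K t τ - (cr F θ hP g₀ os).shB K t τ) δ ∧ Summable δ

/-- **(3) a (B)-free road of v5's N19′ face TRANSFERS TO EVERY VERSION `v` VERBATIM.** -/
theorem keyedCoreEdgeHolderD4V_of_bFree {β : ℝ} {cr : SpineReading} {rr : RateReadingFn} (hfree : KeyedCoreEdgeHolderD4BFree β cr rr) :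
    KeyedCoreEdgeHolderD4V β cr rr :=
  fun F θ h _v hG hθ _ _ => hfree F θ h.toCore hG hθ

/-- … and gives v5's own face. -/
theorem keyedCoreEdgeHolderD4_of_bFree {β : ℝ} {cr : SpineReading} {rr : RateReadingFn} (hfree : KeyedCoreEdgeHolderD4BFree β cr rr) :
    KeyedCoreEdgeHolderD4 β cr rr :=
  fun F θ hP hG hθ _ _ => hfree F θ hP hG hθ

/-- CANDIDATE «N27x at the slot»: v5's `KeyedExtraction cr` under the binder `v`, prefix and partition functions read at the revised datum. -/
def KeyedExtractionV (cr : SpineReading) : Prop :=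
  ∀ (F : T4Family) (θ : Stage13HParams F 2) (h : θ.Provisos₁₃SepCoPH F 2) (v : Revision₁₃ F 2 θ h), (θ.ZhUnity F 2 ∧ θ.SlotsNondegenerate₁₃ F 2) → θ.Admissible F 2 →
    B16.EndStatementBPrinted (datumOfRecord₁₃SepCoPHV F 2 θ h v).C → DagBinding.EndpointExistence (datumOfRecord₁₃SepCoPHV F 2 θ h v).C.toB12 →
      ForSmallCouplings (datumOfRecord₁₃SepCoPHV F 2 θ h v) fun g₀ => ∀ os : List (ULoop F),
        0 < (cr F θ h.toCore g₀ os).l₀ ∧ 0 < (cr F θ h.toCore g₀ os).vol ∧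
        (∀ (K : ℕ) (t : ℝ), |t| ≤ (cr F θ h.toCore g₀ os).l₀ →
          T4GenFunBounds.schemeZ ((datumOfRecord₁₃SepCoPHV F 2 θ h v).scheme g₀) os ((cr F θ h.toCore g₀ os).K₀ + K) t =
            ∑ τ ∈ (cr F θ h.toCore g₀ os).T K, (cr F θ h.toCore g₀ os).A K t τ) ∧
        (∀ (K : ℕ) (t : ℝ), |t| ≤ (cr F θ h.toCore g₀ os).l₀ →
          T4GenFunBounds.schemeZ ((datumOfRecord₁₃SepCoPHV F 2 θ h v).scheme g₀) os ((cr F θ h.toCore g₀ os).K₀ + K + 1) t =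
            ∑ τ ∈ (cr F θ h.toCore g₀ os).T K, (cr F θ h.toCore g₀ os).B K t τ)

/-- the (B)-FREE, END-FREE shape of the N27x face. -/
def KeyedExtractionBFree (cr : SpineReading) : Prop :=
  ∀ (F : T4Family) (θ : Stage13HParams F 2) (hP : θ.Provisos₁₃CoPH F 2), (θ.ZhUnity F 2 ∧ θ.SlotsNondegenerate₁₃ F 2) → θ.Admissible F 2 →
    ForSmallCouplings (datumOfRecord₁₃CoPH F 2 θ hP) fun g₀ => ∀ os : List (ULoop F),
      0 < (cr F θ hP g₀ os).l₀ ∧ 0 < (cr F θ hP g₀ os).vol ∧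
      (∀ (K : ℕ) (t : ℝ), |t| ≤ (cr F θ hP g₀ os).l₀ →
        T4GenFunBounds.schemeZ ((datumOfRecord₁₃CoPH F 2 θ hP).scheme g₀) os ((cr F θ hP g₀ os).K₀ + K) t = ∑ τ ∈ (cr F θ hP g₀ os).T K, (cr F θ hP g₀ os).A K t τ) ∧
      (∀ (K : ℕ) (t : ℝ), |t| ≤ (cr F θ hP g₀ os).l₀ →
        T4GenFunBounds.schemeZ ((datumOfRecord₁₃CoPH F 2 θ hP).scheme g₀) os ((cr F θ hP g₀ os).K₀ + K + 1) t = ∑ τ ∈ (cr F θ hP g₀ os).T K, (cr F θ hP g₀ os).B K t τ)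

/-- **(3) a (B)-free road of v5's N27x face TRANSFERS TO EVERY VERSION `v` VERBATIM** (the partition functions are the record's, `schemeZ_slot`). -/
theorem keyedExtractionV_of_bFree {cr : SpineReading} (hfree : KeyedExtractionBFree cr) : KeyedExtractionV cr :=
  fun F θ h _v hG hθ _ _ => hfree F θ h.toCore hG hθ

/-- … and gives v5's own face. -/
theorem keyedExtraction_of_bFree {cr : SpineReading} (hfree : KeyedExtractionBFree cr) : KeyedExtraction cr :=
  fun F θ hP hG hθ _ _ => hfree F θ hP hG hθ

/-! ## §3 What does NOT transfer for free (displayed, not claimed): a road CONSUMING (B) at the record -/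

/-- A v5 K4 face whose proof READS (B) is keyed on (B) AT THE RECORD; at the slot only (B) AT THE REVISED DATUM is in scope.  The transfer holds GIVEN a reader of (B) that is
ρ-a.e.-robust above level 0 — displayed here as the hypothesis `hBdown` («(B) at the revised datum gives whatever the road used of (B) at the record»); DEF-1's
`thm1Printed_datumOfRecord₁₃SepCoPHV_iff` says Thm 1's half is such a reader (`Iff.rfl`), the Cor. 3 half is not (ρ-pointwise).  Nothing asserted. -/
theorem keyedRatesHolderD4V_of_keyed_of_bReader {β : ℝ} {rr : RateReadingFn} (h5 : KeyedRatesHolderD4 β rr)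
    (hBdown : ∀ (F : T4Family) (θ : Stage13HParams F 2) (h : θ.Provisos₁₃SepCoPH F 2) (v : Revision₁₃ F 2 θ h),
      B16.EndStatementBPrinted (datumOfRecord₁₃SepCoPHV F 2 θ h v).C → B16.EndStatementBPrinted (datumOfRecord₁₃SepCoPH F 2 θ h).C) :
    KeyedRatesHolderD4V β rr :=
  fun F θ h v hG hθ hB hE => h5 F θ h.toCore hG hθ (hBdown F θ h v hB) hE

end Summit.QuantumFields.YangMills.Cruxes.SpineGivenEndpointR13SepCoPH.N17W2K3R8VersionSlotProbe

end
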